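import Summits.SmoothPoincare4.SmoothPoincare4.Theorems.CylinderEntropyImmortalAreaToFloorGoodPoints
import Mathlib.MeasureTheory.Measure.Haar.InnerProductSpace
import Mathlib.MeasureTheory.Integral.Bochner.Basic
import Mathlib.MeasureTheory.Measure.Real
import HarnessLib

/-!
# Route `CylinderEntropy`, item `ImmortalAreaToFloor` (stmt-SmoothPoincare4-17197):
# the GOOD SET of a cross-section (module Γ1 of `BLUEPRINT-17197-c2.md`, concrete form)

For a finite measure `μ` on a space `M` mapped continuously into `ℝ⁶` by `f`, two continuous
non-negative integrable densities `φ` (the tilt density `|ν'|²`) and `ψ` (the Willmore density `H²`),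
thresholds `ξ, θ > 0` and a radius `R`, `exists_goodSet` produces a MEASURABLE set `G ⊆ M` with
* pointwise tilt control `φ ≤ ξ` on `G`;
* relative smallness on all balls up to radius `R` centred at its points:
  `∫_{f⁻¹B̄(f w,r)} φ dμ ≤ ξ μ(f⁻¹B̄(f w,r))` and `∫_{f⁻¹B̄(f w,r)} ψ dμ ≤ θ μ(f⁻¹B̄(f w,r))`, `0 < r ≤ R`;
* small complement: `μ(M ∖ G) ≤ (N+1) (∫φ)/ξ + N (∫ψ)/θ`, `N` the Besicovitch constant of `ℝ⁶`.
It is the landed Besicovitch weak-type bound (`GoodPoints.exists_forall_measure_badSet_le`) for the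
push-forward measures `f_*μ`, `f_*(φμ)`, `f_*(ψμ)` on `ℝ⁶`, a measurable hull of the bad set, and
Markov's inequality for the pointwise condition.

References: W. K. Allard, Ann. of Math. 95 (1972) §6 (good points); H. Federer, *GMT*, 2.8.14.
-/

noncomputable section

-- the prescribed namespace `Summit.SmoothPoincare4.SmoothPoincare4.…` repeats `SmoothPoincare4`
set_option linter.dupNamespace false

open MeasureTheory Metric Set Filter
open scoped ENNReal NNReal Topology

namespace Summit.SmoothPoincare4.SmoothPoincare4.Theorems.GoodPoints

/-- **The good set of a cross-section.**  See the module docstring. [cite: Allard1972, §6] -/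
theorem exists_goodSet : ∃ N : ℕ, ∀ (M : Type) [TopologicalSpace M] [MeasurableSpace M] [BorelSpace M]
    (μ : Measure M) [IsFiniteMeasure μ] (f : M → EuclideanSpace ℝ (Fin 6)), Continuous f →
    ∀ (φ ψ : M → ℝ), Continuous φ → Continuous ψ → (∀ w, 0 ≤ φ w) → (∀ w, 0 ≤ ψ w) →
    Integrable φ μ → Integrable ψ μ → ∀ (ξ θ R : ℝ), 0 < ξ → 0 < θ →
    ∃ G : Set M, MeasurableSet G ∧ (∀ w ∈ G, φ w ≤ ξ) ∧
      (∀ w ∈ G, ∀ r, 0 < r → r ≤ R →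
        ∫ a in f ⁻¹' closedBall (f w) r, φ a ∂μ ≤ ξ * μ.real (f ⁻¹' closedBall (f w) r)) ∧
      (∀ w ∈ G, ∀ r, 0 < r → r ≤ R →
        ∫ a in f ⁻¹' closedBall (f w) r, ψ a ∂μ ≤ θ * μ.real (f ⁻¹' closedBall (f w) r)) ∧
      μ.real Gᶜ ≤ (N + 1) * ((∫ a, φ a ∂μ) / ξ) + N * ((∫ a, ψ a ∂μ) / θ) := by
  obtain ⟨N, hN⟩ := exists_forall_measure_badSet_le (EuclideanSpace ℝ (Fin 6))
  refine ⟨N, ?_⟩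
  intro M _ _ _ μ _ f hf φ ψ hφc hψc hφ0 hψ0 hφi hψi ξ θ R hξ hθ
  have hfm : Measurable f := hf.measurable
  -- push-forward measures on `ℝ⁶`
  set μ' : Measure (EuclideanSpace ℝ (Fin 6)) := μ.map f with hμ'
  set νφ : Measure M := μ.withDensity fun a => ENNReal.ofReal (φ a) with hνφ
  set νψ : Measure M := μ.withDensity fun a => ENNReal.ofReal (ψ a) with hνψ
  set βφ : Measure (EuclideanSpace ℝ (Fin 6)) := νφ.map f with hβφ
  set βψ : Measure (EuclideanSpace ℝ (Fin 6)) := νψ.map f with hβψ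
  have hξ0 : ENNReal.ofReal ξ ≠ 0 := (ENNReal.ofReal_pos.2 hξ).ne'
  have hθ0 : ENNReal.ofReal θ ≠ 0 := (ENNReal.ofReal_pos.2 hθ).ne'
  -- the bad sets and their Besicovitch bounds
  set Bφ : Set (EuclideanSpace ℝ (Fin 6)) := {x | ∃ r : ℝ, 0 < r ∧ r ≤ R ∧
    ENNReal.ofReal ξ * μ' (closedBall x r) < βφ (closedBall x r)} with hBφ
  set Bψ : Set (EuclideanSpace ℝ (Fin 6)) := {x | ∃ r : ℝ, 0 < r ∧ r ≤ R ∧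
    ENNReal.ofReal θ * μ' (closedBall x r) < βψ (closedBall x r)} with hBψ
  have hBφle : μ' Bφ ≤ N * βφ univ / ENNReal.ofReal ξ := hN μ' βφ _ hξ0 ENNReal.ofReal_ne_top R
  have hBψle : μ' Bψ ≤ N * βψ univ / ENNReal.ofReal θ := hN μ' βψ _ hθ0 ENNReal.ofReal_ne_top R
  -- evaluation of the push-forwards on measurable sets
  have hμ'ap : ∀ s, MeasurableSet s → μ' s = μ (f ⁻¹' s) := fun s hs => by
    rw [hμ', Measure.map_apply hfm hs]
  have hβφap : ∀ s, MeasurableSet s → βφ s = ENNReal.ofReal (∫ a in f ⁻¹' s, φ a ∂μ) := by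
    intro s hs
    rw [hβφ, Measure.map_apply hfm hs, hνφ, withDensity_apply _ (hfm hs),
      ofReal_integral_eq_lintegral_ofReal hφi.integrableOn (Eventually.of_forall fun a => hφ0 a)]
  have hβψap : ∀ s, MeasurableSet s → βψ s = ENNReal.ofReal (∫ a in f ⁻¹' s, ψ a ∂μ) := by
    intro s hs
    rw [hβψ, Measure.map_apply hfm hs, hνψ, withDensity_apply _ (hfm hs),
      ofReal_integral_eq_lintegral_ofReal hψi.integrableOn (Eventually.of_forall fun a => hψ0 a)]
  -- measurable hull of the bad set
  set B' : Set (EuclideanSpace ℝ (Fin 6)) := toMeasurable μ' (Bφ ∪ Bψ) with hB'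
  have hB'm : MeasurableSet B' := measurableSet_toMeasurable _ _
  have hsubB' : Bφ ∪ Bψ ⊆ B' := subset_toMeasurable _ _
  -- the pointwise tilt set
  set P : Set M := {w | ξ < φ w} with hP
  have hPm : MeasurableSet P := (isOpen_lt continuous_const hφc).measurableSet
  -- the good set
  refine ⟨(f ⁻¹' B' ∪ P)ᶜ, ((hfm hB'm).union hPm).compl, ?_, ?_, ?_, ?_⟩
  · intro w hw
    have : w ∉ P := fun h => hw (Or.inr h)
    exact not_lt.1 this
  · intro w hw r hr hrR
    have hwB : f w ∉ Bφ := fun h => hw (Or.inl (hsubB' (Or.inl h)))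
    have hnot : ¬ ENNReal.ofReal ξ * μ' (closedBall (f w) r) < βφ (closedBall (f w) r) :=
      fun h => hwB ⟨r, hr, hrR, h⟩
    rw [not_lt, hμ'ap _ measurableSet_closedBall, hβφap _ measurableSet_closedBall] at hnot
    have hfin : μ (f ⁻¹' closedBall (f w) r) ≠ ⊤ := measure_ne_top _ _
    rw [← ENNReal.ofReal_toReal hfin, ← ENNReal.ofReal_mul hξ.le] at hnot
    exact (ENNReal.ofReal_le_ofReal_iff (mul_nonneg hξ.le ENNReal.toReal_nonneg)).1 hnot
  · intro w hw r hr hrR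
    have hwB : f w ∉ Bψ := fun h => hw (Or.inl (hsubB' (Or.inr h)))
    have hnot : ¬ ENNReal.ofReal θ * μ' (closedBall (f w) r) < βψ (closedBall (f w) r) :=
      fun h => hwB ⟨r, hr, hrR, h⟩
    rw [not_lt, hμ'ap _ measurableSet_closedBall, hβψap _ measurableSet_closedBall] at hnot
    have hfin : μ (f ⁻¹' closedBall (f w) r) ≠ ⊤ := measure_ne_top _ _
    rw [← ENNReal.ofReal_toReal hfin, ← ENNReal.ofReal_mul hθ.le] at hnot
    exact (ENNReal.ofReal_le_ofReal_iff (mul_nonneg hθ.le ENNReal.toReal_nonneg)).1 hnot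
  · -- the complement is small
    rw [compl_compl]
    have hE0 : 0 ≤ ∫ a, φ a ∂μ := integral_nonneg hφ0
    have hW0 : 0 ≤ ∫ a, ψ a ∂μ := integral_nonneg hψ0
    -- total masses of the weighted measures
    have hβφu : βφ univ = ENNReal.ofReal (∫ a, φ a ∂μ) := by
      rw [hβφap _ MeasurableSet.univ, preimage_univ, Measure.restrict_univ]
    have hβψu : βψ univ = ENNReal.ofReal (∫ a, ψ a ∂μ) := by
      rw [hβψap _ MeasurableSet.univ, preimage_univ, Measure.restrict_univ]
    -- Markov for the pointwise set
    have hPle : μ P ≤ ENNReal.ofReal (∫ a, φ a ∂μ) / ENNReal.ofReal ξ := by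
      have hsub : P ⊆ {w | ENNReal.ofReal ξ ≤ ENNReal.ofReal (φ w)} := fun w hw =>
        ENNReal.ofReal_le_ofReal (le_of_lt hw)
      have hmk := mul_meas_ge_le_lintegral₀ (μ := μ)
        (f := fun w => ENNReal.ofReal (φ w)) (by fun_prop) (ENNReal.ofReal ξ)
      rw [← ofReal_integral_eq_lintegral_ofReal hφi (Eventually.of_forall fun a => hφ0 a)] at hmk
      rw [ENNReal.le_div_iff_mul_le (Or.inl hξ0) (Or.inl ENNReal.ofReal_ne_top), mul_comm]
      exact le_trans (mul_le_mul' le_rfl (measure_mono hsub)) hmk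
    -- the bad preimage
    have hBle : μ (f ⁻¹' B') ≤ N * ENNReal.ofReal (∫ a, φ a ∂μ) / ENNReal.ofReal ξ +
        N * ENNReal.ofReal (∫ a, ψ a ∂μ) / ENNReal.ofReal θ := by
      rw [← hμ'ap _ hB'm, hB', measure_toMeasurable]
      calc μ' (Bφ ∪ Bψ) ≤ μ' Bφ + μ' Bψ := measure_union_le _ _
        _ ≤ N * βφ univ / ENNReal.ofReal ξ + N * βψ univ / ENNReal.ofReal θ := add_le_add hBφle hBψle
        _ = _ := by rw [hβφu, hβψu]
    have htot : μ (f ⁻¹' B' ∪ P) ≤ ENNReal.ofReal ((N + 1) * ((∫ a, φ a ∂μ) / ξ) +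
        N * ((∫ a, ψ a ∂μ) / θ)) := by
      calc μ (f ⁻¹' B' ∪ P) ≤ μ (f ⁻¹' B') + μ P := measure_union_le _ _
        _ ≤ (N * ENNReal.ofReal (∫ a, φ a ∂μ) / ENNReal.ofReal ξ +
              N * ENNReal.ofReal (∫ a, ψ a ∂μ) / ENNReal.ofReal θ) +
            ENNReal.ofReal (∫ a, φ a ∂μ) / ENNReal.ofReal ξ := add_le_add hBle hPle
        _ = ENNReal.ofReal ((N + 1) * ((∫ a, φ a ∂μ) / ξ) + N * ((∫ a, ψ a ∂μ) / θ)) := by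
            rw [← ENNReal.ofReal_natCast N, mul_div_assoc, mul_div_assoc,
              ← ENNReal.ofReal_div_of_pos hξ, ← ENNReal.ofReal_div_of_pos hθ,
              ← ENNReal.ofReal_mul (Nat.cast_nonneg N), ← ENNReal.ofReal_mul (Nat.cast_nonneg N),
              ← ENNReal.ofReal_add (by positivity) (by positivity),
              ← ENNReal.ofReal_add (by positivity) (by positivity)]
            congr 1
            ring
    exact ENNReal.toReal_le_of_le_ofReal (by positivity) htot

end Summit.SmoothPoincare4.SmoothPoincare4.Theorems.GoodPoints

end
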